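import Summits.BirchSwinnertonDyer.BirchSwinnertonDyer.Theorems.TwoAdicConverseOrdLambdaHalfAtTwoGreenbergGL1OfPrint
import HarnessLib

/-!
# Route `TwoAdicConverse` (rung S3), crux `OrdLambdaHalfAtTwo` (item stmt-BirchSwinnertonDyer-19556), line
# `kato-determinant-greenberg-two` (skeleton v3.2 `35652817b5d7`): the print stub `stub_residualGL1PrintAtTwo`'s STATEMENT from the two facts

Cell `bsd-2adic`, seat `bsd-2adic-conv-1` GEN 25 (`--supports` stmt-BirchSwinnertonDyer-19556 `--as helper`; pen RC-317: conv-1 lands helpers,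
the LEAD closes registered stubs).  v3.2's `stub_residualGL1PrintAtTwo` is the conjunction [P1] ∧ [P23] (unfolded, per imaginary
quadratic `K`, cyclotomic `κ`, `Γ_K`-module `M` of order `2`).  [P23] is a kernel theorem (p663165
`finite_quotient_iInf_unramifiedKer_of_not_decomp_le` + `not_decomp_le_kerSubgroup_of_isCyclotomic`); [P1] follows from the two PRINT facts
`ferreroWashington1979_classicalMuVanishes` (Ferrero–Washington) and `classicalMuVanishes_finite_unramifiedClasses` (Iwasawa dictionary,
p662555) by p663939's `finite_unramifiedClasses_of_print`.  Hence:

* **`residualGL1PrintAtTwo_of_facts`** — `ferreroWashington1979_classicalMuVanishes → classicalMuVanishes_finite_unramifiedClasses →`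
  ⟨the statement of `stub_residualGL1PrintAtTwo`, binders verbatim⟩.  The lead's in-file close (v4) is the one-liner
  `residualGL1PrintAtTwo_of_facts h.1 h.2` once the stub is re-typed as the conjunction of the two named facts (pure PRINT, by name).

HONEST FRAMING.  Composition; no definition, no named fact, no `sorry`; CONDITIONAL on two printed named facts; BSD is not proved by any of this.
PARTITION (D-0054): none — RANK axis S3 × X5@2 stratum (β).
-/

set_option linter.dupNamespace false
set_option autoImplicit false

noncomputable section

open scoped Classical

namespace Summit.BirchSwinnertonDyer.BirchSwinnertonDyer.Theorems.TwoAdicGreenbergCotorsion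

open NumberField IsDedekindDomain Field WeierstrassCurve
open Literature Literature.NumberTheory.EllipticCurves Literature.NumberTheory.EllipticCurves.GreenbergSelmer
  Literature.NumberTheory.EllipticCurves.GreenbergVatsal2000 Literature.NumberTheory.GaloisRepresentations
  Literature.NumberTheory.IwasawaTheory

/-- **`stub_residualGL1PrintAtTwo` (v3.2) ⟸ the two PRINT facts.**  For an imaginary quadratic `K`, its cyclotomic `ℤ₂`-extension `κ` and a
discrete `Γ_K`-module `M` of order `2`: [P1] the everywhere-unramified classes of `H¹(ker κ, M)` form a finite set (Ferrero–Washington +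
Iwasawa dictionary, `finite_unramifiedClasses_of_print`) AND [P23] for every `v ∤ 2`, `H¹(ker κ, M)` modulo the classes unramified at every
place above `v` is finite (KERNEL: `finite_quotient_iInf_unramifiedKer_of_not_decomp_le`, every place being finitely decomposed in the
cyclotomic tower).  Binders of the registered stub verbatim. [cite: FerreroWashington1979] [cite: Lang1990, Ch. 5 §4 pp. 137–143]
[cite: GreenbergVatsal2000, §2 Prop. (2.4)] -/
theorem residualGL1PrintAtTwo_of_facts (hFW : ferreroWashington1979_classicalMuVanishes)
    (hI : classicalMuVanishes_finite_unramifiedClasses) :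
    ∀ (K : Type) [Field K] [NumberField K], IsImaginaryQuadratic K →
      ∀ (κK : ZpExtension K 2), κK.IsCyclotomic →
      ∀ (M : Type) [AddCommGroup M] [DistribMulAction (absoluteGaloisGroup K) M]
        [TopologicalSpace M] [DiscreteTopology M], Nat.card M = 2 →
        {c : Literature.NumberTheory.EllipticCurves.subgroupH1 κK.kerSubgroup M |
            ∀ (v : HeightOneSpectrum (𝓞 K)) (σ : absoluteGaloisGroup K),
            Literature.NumberTheory.EllipticCurves.conjH1 κK.kerSubgroup M σ c ∈ unramifiedKer κK.kerSubgroup M v}.Finite ∧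
        ∀ (v : HeightOneSpectrum (𝓞 K)), ((2 : ℕ) : 𝓞 K) ∉ v.asIdeal →
          Finite (Literature.NumberTheory.EllipticCurves.subgroupH1 κK.kerSubgroup M ⧸
            ⨅ σ : absoluteGaloisGroup K, (unramifiedKer κK.kerSubgroup M v).comap
              (Literature.NumberTheory.EllipticCurves.conjH1 κK.kerSubgroup M σ)) := by
  intro K _ _ hK κK hκ M _ _ _ _ hM2
  haveI : Fact (Nat.Prime 2) := ⟨Nat.prime_two⟩
  haveI : Finite M := Nat.finite_of_card_ne_zero (by rw [hM2]; norm_num)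
  have hM : ∃ k : ℕ, Nat.card M = 2 ^ k := ⟨1, by rw [hM2, pow_one]⟩
  have htriv : ∀ (σ : absoluteGaloisGroup K) (m : M), σ • m = m := fun σ m ↦ smul_eq_self_of_natCard_eq_two hM2 σ m
  exact ⟨finite_unramifiedClasses_of_print hFW hI hK κK hκ M hM htriv,
    fun v hpv ↦ finite_quotient_iInf_unramifiedKer_of_not_decomp_le κK M hM htriv hpv
      (not_decomp_le_kerSubgroup_of_isCyclotomic κK hκ v)⟩

end Summit.BirchSwinnertonDyer.BirchSwinnertonDyer.Theorems.TwoAdicGreenbergCotorsion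

end
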